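import Mathlib
import HarnessLib
import Summits.ResolutionOfSingularities.ResolutionOfSingularities.Theorems.WildQuotientsWildQuotientResolutionBlowupExitBasicOpenSections

/-!
# Sections of a stable open through the inclusion: `Γ(X, V) ≃ Γ(↥O, (O.ι ≫ r)⁻¹ ⊤)` equivariantly
(crux stmt-ResolutionOfSingularities-15640 `WildQuotients.WildQuotientResolution`, line `Sketch`;
chain w45c programmes V3U/V4U — the POLYNOMIAL-MODEL companion of the seam p510259 for the ring
bricks `H₀` / `H₁` / `Hₐ` (res-L1-w45c-lead-1 p508076 / p511455): an owner holding a model of the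
chart ring on `Γ(Bl, V)` (e.g. res-type-087's `exists_ringEquiv_blowupChart0_adjoin`, p507969) moves
it to the brick's target `Γ(↥O.1, (O.1.ι ≫ π ≫ q)⁻¹ ⊤)` and reads the `ActionOver.restrict` action and
its invariants through the pull-backs `(ρB.aut g).hom.appLE V V`; written by res-D-pv-033 AS
res-L1-w45c-stub-5; [OURS · L1 W4.5c] — generic scheme glue, NOT a statement of any manuscript.)

* `BlowupExit.exists_sectionsEquiv_appLE` — for an `ActionOver r G` on `X`, a `G`-stable open `O`,
  an open `V` with `O = V` (the bricks carry `O.1 = <chart>` as a hypothesis) and the brick's `hle`: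
  a ring isomorphism `Ξ : Γ(X, V) ≃+* Γ(↥O, (O.ι ≫ r)⁻¹ ⊤)` with (a) `Ξ z = O.ι.appLE V _ hle z`,
  (b) `(ρ.restrict O hO).act g (Ξ z) = Ξ ((ρ.aut g⁻¹)^* z)`, (c) `Ξ z` invariant `↔` `z` is fixed by
  every `(ρ.aut g⁻¹)^*` `↔` by every `(ρ.aut g)^*`.
-/

-- single-problem summit: the doubled namespace component `ResolutionOfSingularities` is forced
set_option linter.dupNamespace false

noncomputable section

open CategoryTheory AlgebraicGeometry TopologicalSpace
open Literature.AlgebraicGeometry.Resolution Literature.AlgebraicGeometry.RelativeSpec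

namespace Summit.ResolutionOfSingularities.ResolutionOfSingularities.Theorems.WildQuotientResolution.BlowupExit

universe u

/-- **Sections of a stable open through the inclusion, equivariantly.** For a `G`-stable open `O`
of `X` (an `ActionOver r G`), `V` an open with `O = V`, and `hle`, the restriction
`O.ι.appLE V ((O.ι ≫ r)⁻¹ ⊤) hle : Γ(X, V) → Γ(↥O, (O.ι ≫ r)⁻¹ ⊤)` is a ring ISOMORPHISM `Ξ`, with
(b) `(ρ.restrict O hO).act g (Ξ z) = Ξ ((ρ.aut g⁻¹).hom.appLE V V _ z)` and (c) `Ξ z` is an invariant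
section iff `z` is fixed by all the pull-backs `(ρ.aut g⁻¹).hom.appLE V V _`, iff by all
`(ρ.aut g).hom.appLE V V _`. [folklore] -/
theorem exists_sectionsEquiv_appLE {X Y : Scheme.{u}} {r : X ⟶ Y} {G : Type*} [Group G]
    (ρ : ActionOver r G) (O : X.Opens) (hO : ∀ g : G, (ρ.aut g).hom ⁻¹ᵁ O = O)
    (V : X.Opens) (hOV : O = V) (hle : (O.ι ≫ r) ⁻¹ᵁ ⊤ ≤ O.ι ⁻¹ᵁ V) :
    ∃ Ξ : Γ(X, V) ≃+* Γ((O : Scheme.{u}), (O.ι ≫ r) ⁻¹ᵁ ⊤),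
      (∀ z, Ξ z = O.ι.appLE V ((O.ι ≫ r) ⁻¹ᵁ ⊤) hle z) ∧
      (∀ (g : G) z, (ρ.restrict O hO).act g ⊤ (Ξ z) =
        Ξ ((ρ.aut g⁻¹).hom.appLE V V (hOV ▸ (hO g⁻¹).ge) z)) ∧
      (∀ z, Ξ z ∈ (ρ.restrict O hO).invariantsRing ⊤ ↔
        ∀ g : G, (ρ.aut g⁻¹).hom.appLE V V (hOV ▸ (hO g⁻¹).ge) z = z) ∧
      (∀ z, Ξ z ∈ (ρ.restrict O hO).invariantsRing ⊤ ↔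
        ∀ g : G, (ρ.aut g).hom.appLE V V (hOV ▸ (hO g).ge) z = z) := by
  subst hOV
  have hΞ : O.ι.appLE O ((O.ι ≫ r) ⁻¹ᵁ ⊤) hle = O.topIso.inv := ι_appLE_eq_topIso_inv O hle
  haveI : IsIso (O.ι.appLE O ((O.ι ≫ r) ⁻¹ᵁ ⊤) hle) := by rw [hΞ]; infer_instance
  have hact : ∀ (g : G) z, (ρ.restrict O hO).act g ⊤
      ((asIso (O.ι.appLE O ((O.ι ≫ r) ⁻¹ᵁ ⊤) hle)).commRingCatIsoToRingEquiv z) =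
      (asIso (O.ι.appLE O ((O.ι ≫ r) ⁻¹ᵁ ⊤) hle)).commRingCatIsoToRingEquiv
        ((ρ.aut g⁻¹).hom.appLE O O (hO g⁻¹).ge z) :=
    fun g z => restrict_act_ι_appLE ρ O hO g hle z
  have hinv : ∀ z, (asIso (O.ι.appLE O ((O.ι ≫ r) ⁻¹ᵁ ⊤) hle)).commRingCatIsoToRingEquiv z ∈
      (ρ.restrict O hO).invariantsRing ⊤ ↔
        ∀ g : G, (ρ.aut g⁻¹).hom.appLE O O (hO g⁻¹).ge z = z := by
    intro z
    rw [ActionOver.mem_invariantsRing_iff]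
    refine forall_congr' fun g => ?_
    rw [hact]
    exact (asIso (O.ι.appLE O ((O.ι ≫ r) ⁻¹ᵁ ⊤) hle)).commRingCatIsoToRingEquiv.injective.eq_iff
  refine ⟨(asIso (O.ι.appLE O ((O.ι ≫ r) ⁻¹ᵁ ⊤) hle)).commRingCatIsoToRingEquiv, fun z => rfl,
    hact, hinv, fun z => ?_⟩
  rw [hinv]
  constructor
  · intro h g
    have h' := h g⁻¹
    rwa [appLE_congr_hom (congrArg (fun x => (ρ.aut x).hom) (inv_inv g)) O O] at h'
  · intro h g
    have h' := h g⁻¹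
    exact h'

end Summit.ResolutionOfSingularities.ResolutionOfSingularities.Theorems.WildQuotientResolution.BlowupExit

end
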